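import Mathlib
import Literature.Computability.AlgebraicComplexity.TensorApolarityForms
import Literature.Computability.AlgebraicComplexity.GradedDegeneration

/-!
# Torus degenerations are compatible with the `(210)`/`(120)` product spaces

Topic `Literature/Computability/AlgebraicComplexity`. The step "we may assume `I₁₁₀` is torus fixed"
of the border apolarity method (Conner–Harper–Landsberg 2023, §2.4, for the maximal torus only, which
is all that the `M_⟨2⟩` argument of `BorderApolarityMatMulTwo.lean` needs), PROVED in coordinates:
for weights `e_A : κ → ℕ`, `e_B : μ → ℕ` (exponents of a one-parameter subgroup of the torus of
`GL(A) × GL(B)` acting diagonally on the coordinates), with the induced weights `wt₁ = e_A + e_B` on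
`(1,1,0)`-forms, `wt₂ = e_A + e_A + e_B` on `(2,1,0)`-forms and `wt₃` on `(1,2,0)`-forms (`TensorApolarityForms.lean`):

* `TensorApolarity.wtPart_mulA_single` — the product `f · e_x` shifts weight components by `e_A(x)`;
* `TensorApolarity.prodA_grSub_sup_altA_le` — `gr(F)·A^* + Alt ⊆ gr(F·A^* + Alt)` (and the `B`
  version), whence
* `TensorApolarity.exists_graded_degeneration` — if a subspace `F` of bilinear forms inside a graded
  subspace `Y` passes the dimension tests `dim F ≥ d`, `dim(F·A^* + Alt) ≤ a`, `dim(F·B^* + Alt) ≤ b`,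
  then so does a GRADED (torus-fixed) subspace `G ⊆ Y`, namely the initial subspace `gr F`
  (`GradedLimit.grSub`, with `dim gr F = dim F` from `GradedDegeneration.lean`).

## References

* A. Conner, A. Harper, J. M. Landsberg, *New lower bounds for matrix multiplication and `det₃`*,
  Forum Math. Pi 11 (2023) e17, arXiv:1911.07981, §2.4 ("we may assume `I_{ijk}` is `𝔹_T`-fixed"),
  §2.5. [ConnerHarperLandsberg2023]
-/

noncomputable section

open Module

namespace Literature.Computability.AlgebraicComplexity

namespace TensorApolarity

universe u

variable {K : Type u} [Field K]
variable {κ μ : Type} [Fintype κ] [Fintype μ] [DecidableEq κ] [DecidableEq μ]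
variable (eA : κ → ℕ) (eB : μ → ℕ)

omit [Fintype κ] [Fintype μ] [DecidableEq κ] [DecidableEq μ] in
/-- The alternating `(2,1,0)` arrays form a graded subspace. [folklore] -/
theorem isGraded_altA : GradedLimit.IsGraded (wt₂ eA eB) (altA K κ μ) := by
  rintro n g ⟨hanti, hdiag⟩
  refine ⟨fun k k' m => ?_, fun k m => ?_⟩
  · have hsym : wt₂ eA eB (k', (k, m)) = wt₂ eA eB (k, (k', m)) := by
      simp only [wt₂_apply]; ring
    simp only [GradedLimit.wtPart_apply, hsym]
    split_ifs
    · exact hanti k k' m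
    · simp
  · simp [hdiag k m]

omit [Fintype κ] [Fintype μ] [DecidableEq κ] [DecidableEq μ] in
/-- The alternating `(1,2,0)` arrays form a graded subspace. [folklore] -/
theorem isGraded_altB : GradedLimit.IsGraded (wt₃ eA eB) (altB K κ μ) := by
  rintro n g ⟨hanti, hdiag⟩
  refine ⟨fun k m m' => ?_, fun k m => ?_⟩
  · have hsym : wt₃ eA eB (k, (m', m)) = wt₃ eA eB (k, (m, m')) := by
      simp only [wt₃_apply]; ring
    simp only [GradedLimit.wtPart_apply, hsym]
    split_ifs
    · exact hanti k m m'
    · simp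
  · simp [hdiag k m]

omit [Fintype κ] [Fintype μ] [DecidableEq μ] in
/-- **Products shift weights**: `π_{n + e_A(x)}(f · e_x) = π_n(f) · e_x`. [folklore] -/
theorem wtPart_mulA_single (n : ℕ) (v : κ × μ → K) (x : κ) :
    GradedLimit.wtPart (wt₂ eA eB) (n + eA x) (mulA v (Pi.single x 1)) =
      mulA (GradedLimit.wtPart (wt₁ eA eB) n v) (Pi.single x 1) := by
  ext ⟨k, k', m⟩
  simp only [GradedLimit.wtPart_apply, mulA_apply, wt₁_apply, wt₂_apply]
  by_cases hk' : k' = x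
  · subst hk'
    by_cases hk : k = k'
    · subst hk
      have hc : (eA k + eA k + eB m = n + eA k) ↔ (eA k + eB m = n) := by omega
      simp only [Pi.single_eq_same, hc]
      split_ifs <;> ring
    · have hc : (eA k + eA k' + eB m = n + eA k') ↔ (eA k + eB m = n) := by omega
      simp only [Pi.single_eq_same, Pi.single_eq_of_ne hk, hc]
      split_ifs <;> ring
  · by_cases hk : k = x
    · subst hk
      have hc : (eA k + eA k' + eB m = n + eA k) ↔ (eA k' + eB m = n) := by omega
      simp only [Pi.single_eq_same, Pi.single_eq_of_ne hk', hc]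
      split_ifs <;> ring
    · simp only [Pi.single_eq_of_ne hk', Pi.single_eq_of_ne hk]
      split_ifs <;> ring

omit [Fintype κ] [Fintype μ] [DecidableEq κ] in
/-- `π_{n + e_B(y)}(f · e_y) = π_n(f) · e_y`. [folklore] -/
theorem wtPart_mulB_single (n : ℕ) (v : κ × μ → K) (y : μ) :
    GradedLimit.wtPart (wt₃ eA eB) (n + eB y) (mulB v (Pi.single y 1)) =
      mulB (GradedLimit.wtPart (wt₁ eA eB) n v) (Pi.single y 1) := by
  ext ⟨k, m, m'⟩
  simp only [GradedLimit.wtPart_apply, mulB_apply, wt₁_apply, wt₃_apply]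
  by_cases hm' : m' = y
  · subst hm'
    by_cases hm : m = m'
    · subst hm
      have hc : (eA k + eB m + eB m = n + eB m) ↔ (eA k + eB m = n) := by omega
      simp only [Pi.single_eq_same, hc]
      split_ifs <;> ring
    · have hc : (eA k + eB m + eB m' = n + eB m') ↔ (eA k + eB m = n) := by omega
      simp only [Pi.single_eq_same, Pi.single_eq_of_ne hm, hc]
      split_ifs <;> ring
  · by_cases hm : m = y
    · subst hm
      have hc : (eA k + eB m + eB m' = n + eB m) ↔ (eA k + eB m' = n) := by omega
      simp only [Pi.single_eq_same, Pi.single_eq_of_ne hm', hc]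
      split_ifs <;> ring
    · simp only [Pi.single_eq_of_ne hm', Pi.single_eq_of_ne hm]
      split_ifs <;> ring

variable [DecidableEq K]

omit [DecidableEq μ] in
/-- `f · e_x` has no component above `topWt f + e_A(x)`. [folklore] -/
theorem mulA_single_mem_Vle (v : κ × μ → K) (x : κ) :
    mulA v (Pi.single x 1) ∈
      GradedLimit.Vle (wt₂ eA eB) (GradedLimit.topWt (wt₁ eA eB) v + eA x) := by
  rintro ⟨k, k', m⟩ hp
  simp only [wt₂_apply] at hp
  have htop := GradedLimit.mem_Vle_topWt (wt₁ eA eB) v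
  simp only [mulA_apply]
  have h1 : v (k, m) * (Pi.single x (1 : K) : κ → K) k' = 0 := by
    by_cases hk' : k' = x
    · subst hk'
      rw [htop (k, m) (by simp only [wt₁_apply]; omega), zero_mul]
    · simp [hk']
  have h2 : v (k', m) * (Pi.single x (1 : K) : κ → K) k = 0 := by
    by_cases hk : k = x
    · subst hk
      rw [htop (k', m) (by simp only [wt₁_apply]; omega), zero_mul]
    · simp [hk]
  rw [h1, h2, add_zero]

omit [DecidableEq κ] in
/-- `f · e_y` has no component above `topWt f + e_B(y)`. [folklore] -/
theorem mulB_single_mem_Vle (v : κ × μ → K) (y : μ) :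
    mulB v (Pi.single y 1) ∈
      GradedLimit.Vle (wt₃ eA eB) (GradedLimit.topWt (wt₁ eA eB) v + eB y) := by
  rintro ⟨k, m, m'⟩ hp
  simp only [wt₃_apply] at hp
  have htop := GradedLimit.mem_Vle_topWt (wt₁ eA eB) v
  simp only [mulB_apply]
  have h1 : v (k, m) * (Pi.single y (1 : K) : μ → K) m' = 0 := by
    by_cases hm' : m' = y
    · subst hm'
      rw [htop (k, m) (by simp only [wt₁_apply]; omega), zero_mul]
    · simp [hm']
  have h2 : v (k, m') * (Pi.single y (1 : K) : μ → K) m = 0 := by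
    by_cases hm : m = y
    · subst hm
      rw [htop (k, m') (by simp only [wt₁_apply]; omega), zero_mul]
    · simp [hm]
  rw [h1, h2, add_zero]

/-- **`gr(F) · A^* + Alt ⊆ gr(F · A^* + Alt)`**: the `(210)` product space of the torus limit is
contained in the torus limit of the `(210)` product space (so the `(210)` test is inherited by the
limit). [cite: ConnerHarperLandsberg2023, §2.4] -/
theorem prodA_grSub_sup_altA_le (F : Submodule K (κ × μ → K)) :
    prodA (GradedLimit.grSub (wt₁ eA eB) F) ⊔ altA K κ μ ≤
      GradedLimit.grSub (wt₂ eA eB) (prodA F ⊔ altA K κ μ) := by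
  refine sup_le ?_ ?_
  · refine iSup_le fun x => ?_
    rw [GradedLimit.grSub, Submodule.map_span_le]
    rintro _ ⟨v, hv, rfl⟩
    rw [mulALin_apply, GradedLimit.topPart, ← wtPart_mulA_single]
    exact GradedLimit.wtPart_mem_grSub _ (Submodule.mem_sup_left (mulA_single_mem_prodA hv x))
      (mulA_single_mem_Vle eA eB v x)
  · exact GradedLimit.le_grSub_of_isGraded _ (isGraded_altA eA eB) le_sup_right

/-- **`gr(F) · B^* + Alt ⊆ gr(F · B^* + Alt)`**. [cite: ConnerHarperLandsberg2023, §2.4] -/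
theorem prodB_grSub_sup_altB_le (F : Submodule K (κ × μ → K)) :
    prodB (GradedLimit.grSub (wt₁ eA eB) F) ⊔ altB K κ μ ≤
      GradedLimit.grSub (wt₃ eA eB) (prodB F ⊔ altB K κ μ) := by
  refine sup_le ?_ ?_
  · refine iSup_le fun y => ?_
    rw [GradedLimit.grSub, Submodule.map_span_le]
    rintro _ ⟨v, hv, rfl⟩
    rw [mulBLin_apply, GradedLimit.topPart, ← wtPart_mulB_single]
    exact GradedLimit.wtPart_mem_grSub _ (Submodule.mem_sup_left (mulB_single_mem_prodB hv y))
      (mulB_single_mem_Vle eA eB v y)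
  · exact GradedLimit.le_grSub_of_isGraded _ (isGraded_altB eA eB) le_sup_right

/-- **Torus-fixed reduction** (CHL 2023 §2.4 for the maximal torus): if some subspace `F` of
bilinear forms inside a graded subspace `Y` satisfies `d ≤ dim F`, `dim(F·A^* + Alt) ≤ a`,
`dim(F·B^* + Alt) ≤ b`, then so does a GRADED subspace `G ⊆ Y` (namely the initial subspace
`gr F`). [cite: ConnerHarperLandsberg2023, §2.4] -/
theorem exists_graded_degeneration {Y F : Submodule K (κ × μ → K)}
    (hY : GradedLimit.IsGraded (wt₁ eA eB) Y) (hF : F ≤ Y) {d a b : ℕ} (hd : d ≤ finrank K F)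
    (ha : finrank K ↥(prodA F ⊔ altA K κ μ) ≤ a) (hb : finrank K ↥(prodB F ⊔ altB K κ μ) ≤ b) :
    ∃ G : Submodule K (κ × μ → K), G ≤ Y ∧ GradedLimit.IsGraded (wt₁ eA eB) G ∧
      d ≤ finrank K G ∧ finrank K ↥(prodA G ⊔ altA K κ μ) ≤ a ∧
      finrank K ↥(prodB G ⊔ altB K κ μ) ≤ b := by
  refine ⟨GradedLimit.grSub (wt₁ eA eB) F, GradedLimit.grSub_le _ hF hY,
    GradedLimit.isGraded_grSub _ F, ?_, ?_, ?_⟩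
  · rwa [GradedLimit.finrank_grSub]
  · calc finrank K ↥(prodA (GradedLimit.grSub (wt₁ eA eB) F) ⊔ altA K κ μ)
        ≤ finrank K (GradedLimit.grSub (wt₂ eA eB) (prodA F ⊔ altA K κ μ)) :=
          Submodule.finrank_mono (prodA_grSub_sup_altA_le eA eB F)
      _ = finrank K ↥(prodA F ⊔ altA K κ μ) := GradedLimit.finrank_grSub _ _
      _ ≤ a := ha
  · calc finrank K ↥(prodB (GradedLimit.grSub (wt₁ eA eB) F) ⊔ altB K κ μ)
        ≤ finrank K (GradedLimit.grSub (wt₃ eA eB) (prodB F ⊔ altB K κ μ)) :=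
          Submodule.finrank_mono (prodB_grSub_sup_altB_le eA eB F)
      _ = finrank K ↥(prodB F ⊔ altB K κ μ) := GradedLimit.finrank_grSub _ _
      _ ≤ b := hb

end TensorApolarity

end Literature.Computability.AlgebraicComplexity

end
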